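import Mathlib
import Literature.Computability.Complexity.SymmetricCircuit
import Literature.Computability.Complexity.CircuitComposition
import Literature.Computability.Complexity.NegationElimination
import Literature.Computability.Complexity.CircuitRestriction
import Summits.PneNP.PneNP.Theorems.SymmetryBudgetWindowBarrierStubHeaderHardwiring

/-!
# Type-changing hard-wiring of symmetric circuits (helper for crux `SymmetryBudget.WindowBarrier`,
item stmt-PneNP-2145, line `canonical-form-completeness`, stub S4)

The relocation calculus of `SymmetryBudgetWindowBarrierStubHeaderHardwiring.lean`
(`HeaderHardwiring.exists_isInducedAut_hardwire`: automorphisms of a circuit survive prefixing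
arity-`0` gates and rewiring the inputs along an equivariant wiring) in the TWO-SORTED form needed
to change the input type: a circuit `C` over inputs `ι` is relocated, behind a prefix `pre` of
wireless gates, along a wiring `φ : ι → κ ⊕ ℕ` into a circuit `D` over inputs `κ`; if `φ`
intertwines a map `π : ι → ι` with a map `π' : κ → κ` (`φ (π q) = (π' ⊕ id) (φ q)`), every
automorphism of `C` over `π` lifts to the automorphism `id ⊕ σ` of `D` over `π'`
(`exists_isInducedAut_hardwire₂`); `D` computes `C` on the inputs read off the wiring
(`eval_hardwire₂`), keeps the basis (`isOver_hardwire₂`) and has `|pre|` more gates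
(`size_hardwire₂`, `exists_hardwire₂`). Used by `SymmetryBudgetWindowBarrierCoreReduction.lean` to
turn a `Bud(n+g, g)`-symmetric circuit on `(n+g) × (n+g)` matrix inputs into a `Sym(Fin g)`-symmetric
circuit on `g × g` inputs. Folklore (Anderson–Dawar 2017, §2, restrictions of symmetric circuits;
Vollmer 1999, §1.2, composition of circuits).
-/

-- `Summit.PneNP.PneNP.…` duplicates `PneNP` BY DESIGN (single-problem summit).
set_option linter.dupNamespace false

namespace Summit.PneNP.PneNP.Theorems

open Literature.Computability.Complexity Literature.Computability.Complexity.GateList Filter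
open scoped Classical

namespace CoreReduction

variable {ι κ : Type*}

/-! ### Type-changing hard-wiring: relocating a circuit over `ι` as a circuit over `κ` -/

/-- The key commutation identity, two-sorted form: if the index relabelling of `τ` is that of `σ`
lifted behind `L` fixed gates and the wiring `φ : ι → κ ⊕ ℕ` intertwines `π : ι → ι` with
`π' : κ → κ` (`φ (π q) = (π' ⊕ id) (φ q)`), then relabelling by `(π', τ)` after shifting equals
shifting after relabelling by `(π, σ)`. -/
theorem relabelWire_shiftWire₂ {n N L : ℕ} (π : ι → ι) (π' : κ → κ) (σ : Equiv.Perm (Fin n))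
    (τ : Equiv.Perm (Fin N))
    (hτ : ∀ k : ℕ, Circuit.relabelGate τ k =
      if k < L then k else Circuit.relabelGate σ (k - L) + L)
    (φ : ι → κ ⊕ ℕ) (hφ : WiresOK L φ) (hφπ : ∀ q, φ (π q) = Sum.map π' id (φ q))
    (w : ι ⊕ ℕ) :
    Circuit.relabelWire π' τ (shiftWire φ L w) = shiftWire φ L (Circuit.relabelWire π σ w) := by
  cases w with
  | inl q =>
    simp only [shiftWire, Circuit.relabelWire_inl]
    rw [hφπ q]
    cases hq : φ q with
    | inl q' => rfl
    | inr c =>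
      have hc : c < L := hφ q c hq
      rw [Circuit.relabelWire_inr, hτ, if_pos hc]
      rfl
  | inr k =>
    simp only [shiftWire, Circuit.relabelWire_inr]
    have h1 : ¬ k + L < L := by omega
    rw [hτ, if_neg h1, Nat.add_sub_cancel]

/-- **Automorphisms survive type-changing hard-wiring.** `D` over `κ` is the prefix `pre` of
arity-`0` gates followed by `C` (over `ι`) relocated along `φ : ι → κ ⊕ ℕ`; if `φ` intertwines
`π` with `π'`, every automorphism of `C` over `π` lifts to an automorphism of `D` over `π'`. -/
theorem exists_isInducedAut_hardwire₂ (pre : List (Gate κ)) (hpre : ∀ g ∈ pre, g.arity = 0)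
    (C : Circuit ι) (D : Circuit κ) (φ : ι → κ ⊕ ℕ) (hφ : WiresOK pre.length φ)
    (hDg : D.gates = pre ++ C.gates.map (reloc φ pre.length))
    (hDo : D.output = shiftWire φ pre.length C.output)
    {π : ι → ι} {π' : κ → κ} (hφπ : ∀ q, φ (π q) = Sum.map π' id (φ q))
    {σ : Equiv.Perm (Fin C.gates.length)} (hσ : C.IsInducedAut π σ) :
    ∃ τ : Equiv.Perm (Fin D.gates.length), D.IsInducedAut π' τ := by
  obtain ⟨Dg, Do, hwf, ho⟩ := D
  dsimp only at hDg hDo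
  subst hDg hDo
  have hN : (pre ++ C.gates.map (reloc φ pre.length)).length = C.gates.length + pre.length := by
    simp only [List.length_append, List.length_map]
    omega
  obtain ⟨τ, hτ⟩ := HeaderHardwiring.exists_liftPerm pre.length hN σ
  have hcomm := relabelWire_shiftWire₂ π π' σ τ hτ φ hφ hφπ
  refine ⟨τ, ?_, ?_⟩
  · show Circuit.relabelWire π' τ (shiftWire φ pre.length C.output) =
      shiftWire φ pre.length C.output
    rw [hcomm, hσ.1]
  · rintro ⟨j, hj⟩
    have hjN : j < C.gates.length + pre.length := by rw [← hN]; exact hj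
    simp only [Fin.getElem_fin]
    rcases Nat.lt_or_ge j pre.length with hjL | hjL
    · have hv : ((τ ⟨j, hj⟩ : Fin _) : ℕ) = j := by
        rw [← Circuit.relabelGate_of_lt τ hj, hτ j, if_pos hjL]
      rw [getElem_congr_idx hv]
      rw [List.getElem_append_left hjL]
      refine ⟨rfl, ?_⟩
      have h0 : (pre[j]).arity = 0 := hpre _ (List.getElem_mem hjL)
      rw [List.ofFn_eq_nil_iff.2 h0, List.map_nil]
    · obtain ⟨k, rfl⟩ : ∃ k, j = k + pre.length := ⟨j - pre.length, by omega⟩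
      have hk : k < C.gates.length := by omega
      have hv : ((τ ⟨k + pre.length, hj⟩ : Fin _) : ℕ) = (σ ⟨k, hk⟩ : ℕ) + pre.length := by
        have h1 : ¬ k + pre.length < pre.length := by omega
        rw [← Circuit.relabelGate_of_lt τ hj, hτ, if_neg h1, Nat.add_sub_cancel,
          Circuit.relabelGate_of_lt σ hk]
      rw [getElem_congr_idx hv]
      rw [HeaderHardwiring.getElem_append_map_add pre C.gates (reloc φ pre.length) (σ ⟨k, hk⟩)
          (σ ⟨k, hk⟩).2,
        HeaderHardwiring.getElem_append_map_add pre C.gates (reloc φ pre.length) k hk]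
      obtain ⟨hfn, hperm⟩ := hσ.2 ⟨k, hk⟩
      simp only [Fin.getElem_fin] at hfn hperm
      refine ⟨by rw [reloc_fn, reloc_fn]; exact hfn, ?_⟩
      rw [HeaderHardwiring.ofFn_reloc_args, HeaderHardwiring.ofFn_reloc_args]
      have hmm : ((List.ofFn (C.gates[k]).args).map (Circuit.relabelWire π σ)).map
            (shiftWire φ pre.length) =
          ((List.ofFn (C.gates[k]).args).map (shiftWire φ pre.length)).map
            (Circuit.relabelWire π' τ) := by
        rw [List.map_map, List.map_map]
        exact List.map_congr_left fun w _ => (hcomm w).symm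
      rw [← hmm]
      exact hperm.map _

/-- The type-changing hard-wired program computes `C` on the inputs read off the wiring. -/
theorem eval_hardwire₂ (pre : List (Gate κ)) (C : Circuit ι) (D : Circuit κ) (φ : ι → κ ⊕ ℕ)
    (hφ : WiresOK pre.length φ) (hDg : D.gates = pre ++ C.gates.map (reloc φ pre.length))
    (hDo : D.output = shiftWire φ pre.length C.output) (x : κ → Bool) :
    D.eval x = C.eval (fun i => wireOf x (vals pre x) (φ i)) := by
  rw [circuit_eval, circuit_eval, hDg, hDo, vals_append_reloc pre C.gates φ hφ x,
    wireOf_shiftWire x _ _ (length_vals pre x) φ hφ]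

/-- The type-changing hard-wired program is over any basis containing the prefix and `C`. -/
theorem isOver_hardwire₂ {B : Set GateFn} (pre : List (Gate κ)) (hpre : ∀ g ∈ pre, g.fn ∈ B)
    (C : Circuit ι) (D : Circuit κ) (hC : C.IsOver B) (φ : ι → κ ⊕ ℕ) (L : ℕ)
    (hDg : D.gates = pre ++ C.gates.map (reloc φ L)) : D.IsOver B := by
  intro g hg
  rw [hDg, List.mem_append, List.mem_map] at hg
  rcases hg with hg | ⟨g', hg', rfl⟩
  · exact hpre g hg
  · rw [reloc_fn]
    exact hC g' hg'

/-- The type-changing hard-wired program has `|pre|` more gates than `C`. -/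
theorem size_hardwire₂ (pre : List (Gate κ)) (C : Circuit ι) (D : Circuit κ) (φ : ι → κ ⊕ ℕ)
    (L : ℕ) (hDg : D.gates = pre ++ C.gates.map (reloc φ L)) :
    D.size = C.size + pre.length := by
  simp only [Circuit.size, hDg, List.length_append, List.length_map]
  omega

/-- The type-changing hard-wired program exists as a `Circuit`. -/
theorem exists_hardwire₂ (pre : List (Gate κ)) (hpre : WF pre) (C : Circuit ι) (φ : ι → κ ⊕ ℕ)
    (hφ : WiresOK pre.length φ) :
    ∃ D : Circuit κ, D.gates = pre ++ C.gates.map (reloc φ pre.length) ∧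
      D.output = shiftWire φ pre.length C.output := by
  have hout : WiresOK C.gates.length (fun _ : Unit => C.output) := fun _ k hk => C.wf_output k hk
  have ho := wiresOK_shiftWire hφ hout
  refine ⟨toCircuit (pre ++ C.gates.map (reloc φ pre.length)) (shiftWire φ pre.length C.output)
    (hpre.append_reloc (wf_gates C) hφ) (fun k hk => ?_), rfl, rfl⟩
  have := ho () k hk
  simp only [List.length_append, List.length_map]
  exact this

end CoreReduction

/-- **Registered sub-goal `stub_typeChangingHardwire`** (crux stmt-PneNP-2145, helper of S4): the
type-changing hard-wiring lemma `CoreReduction.exists_isInducedAut_hardwire₂` at universe `0`, all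
binders explicit — automorphisms of `C` over `π` lift to automorphisms of the relocated circuit `D`
over `π'` whenever the wiring intertwines `π` with `π'`. -/
theorem stub_typeChangingHardwire : ∀ (ι κ : Type) (pre : List (Gate κ)), (∀ g ∈ pre, g.arity = 0) → ∀ (C : Circuit ι) (D : Circuit κ) (φ : ι → κ ⊕ ℕ), WiresOK pre.length φ → D.gates = pre ++ C.gates.map (reloc φ pre.length) → D.output = shiftWire φ pre.length C.output → ∀ (π : ι → ι) (π' : κ → κ), (∀ q, φ (π q) = Sum.map π' id (φ q)) → ∀ σ : Equiv.Perm (Fin C.gates.length), C.IsInducedAut π σ → ∃ τ : Equiv.Perm (Fin D.gates.length), D.IsInducedAut π' τ :=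
  fun _ _ pre hpre C D φ hφ hDg hDo _ _ hφπ _ hσ =>
    CoreReduction.exists_isInducedAut_hardwire₂ pre hpre C D φ hφ hDg hDo hφπ hσ

end Summit.PneNP.PneNP.Theorems
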